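import Summits.ResolutionOfSingularities.ResolutionOfSingularities.Theorems.FrobeniusClosingPatchingRelPerfectMonomialRouteKStepData
import HarnessLib

/-!
# Crux `PatchingRelPerfect` (stmt-ResolutionOfSingularities-16161), chain w52 — TargetsF3 (m)
# «M2-strong», COMBINATORIAL HALF, Route K step K13b: the new charts READ the new boundary — labels,
# cones, (C1) and (C1') at the next level

[OURS · L1 W5.2 · design memo v3 (`L/res-type-075/M2STRONG-COMBINATORIAL-HALF.md`); fact-free;
nothing here is a statement of the manuscript under review]

For the data of file K13a (`newD`, `newCharts` on `Bl_C Y` after a block play `mv` of the components of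
the head centre `C` of a `Good` level): the labellings of the new charts are injective
(`Good.newCharts_lab_inj`), their cones are `insert e (cone ∖ {lab j})` resp. the old cone
(`cone_famChart`), indices that are not live carry `⊤` (`Good.newD_top`), and the readings (C1)/(C1'):
**`Good.img_newD`** — the new chart reads `newD (lab' b)` as `(x_b)` (the strict transform of `V(x_b)`
for `b ≠ j`, the exceptional piece over the seen component for `b = j`; files K12a/K12b), and
**`Good.img_newD_top`** — a new divisor not labelled in the new cone is read as `⊤` (it misses the
chart; uses the chart consistency of file K9 to separate the exceptional pieces of different
components).
-/

-- `Summit.<Summit>.<Sub>.Theorems` with `Sub = Summit` (single-conjunct summit, D-0017)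
set_option linter.dupNamespace false

noncomputable section

open CategoryTheory AlgebraicGeometry TopologicalSpace MvPolynomial
open Literature.AlgebraicGeometry.Resolution

namespace Summit.ResolutionOfSingularities.ResolutionOfSingularities.Theorems

namespace PolyhedraGame

namespace RouteK

variable {L : Finset ℕ} {m : ℕ} {s : State} {Y : Scheme.{0}} {D : ℕ → Y.IdealSheafData} {M : MarkedIdeal Y}
  {C : Y.IdealSheafData} {rest : CentreSeq (blowup C)} {𝒞 : Set (Chart L Y)}

/-! ## Labels and cones of the new charts -/

/-- [OURS] The cone of a chart of the blow-up family: the old cone with the label of the blown-up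
variable replaced by the exceptional name. -/
theorem cone_famChart (c : Chart L Y) (hinj : Set.InjOn c.lab (L : Set ℕ)) (S : Finset L)
    (hS : c.img C = coordIdeal S) (j : S) (e : ℕ) :
    (famChart c S hS j e).cone = insert e (c.cone.erase (c.lab (j : L))) := by
  ext l
  simp only [Chart.cone, famChart, Chart.ofMap_lab, Finset.mem_image, Finset.mem_insert, Finset.mem_erase]
  constructor
  · rintro ⟨b, hb, rfl⟩
    by_cases hbj : b = ((j : L) : ℕ)
    · subst hbj; exact Or.inl (Function.update_self ..)
    · rw [Function.update_of_ne hbj]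
      refine Or.inr ⟨fun h => hbj (hinj hb (j : L).2 h), b, hb, rfl⟩
  · rintro (rfl | ⟨hne, b, hb, rfl⟩)
    · exact ⟨(j : L), (j : L).2, Function.update_self ..⟩
    · refine ⟨b, hb, ?_⟩
      rw [Function.update_of_ne]
      intro h; apply hne; rw [h]

/-- [OURS] The cone of a lifted chart is the old cone. -/
theorem cone_liftChart (c : Chart L Y) (htop : c.img C = ⊤) : (liftChart c htop).cone = c.cone := rfl

/-- [OURS] The label of the blown-up variable in a chart of the family is the exceptional name. -/
theorem famChart_lab_self (c : Chart L Y) (S : Finset L) (hS : c.img C = coordIdeal S) (j : S) (e : ℕ) :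
    (famChart c S hS j e).lab (j : L) = e := by
  simp [famChart, Chart.ofMap_lab]

/-- [OURS] The other labels of a chart of the family are the old ones. -/
theorem famChart_lab_of_ne (c : Chart L Y) (S : Finset L) (hS : c.img C = coordIdeal S) (j : S) (e : ℕ)
    {b : L} (hb : b ≠ (j : L)) : (famChart c S hS j e).lab b = c.lab b := by
  simp only [famChart, Chart.ofMap_lab]
  exact Function.update_of_ne (fun h => hb (Subtype.ext h)) _ _

section StepFields

variable (G : Good L m s Y D M (CentreSeq.cons C rest) 𝒞) (hm : 1 ≤ m) (hs : s.WF)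
  {mv : List (Finset ℕ × ℕ)} (hmv : BlockPlay m s G.components mv)
include G hm hs hmv

/-- [OURS] The labels of an old chart are live indices. -/
theorem Good.lab_mem_B {c : Chart L Y} (hc : c ∈ 𝒞) (b : L) : c.lab b ∈ s.B := by
  have _ := hm; have _ := hmv
  exact hs.str_subset _ (G.cone_mem c hc) (Finset.mem_image_of_mem _ b.2)

/-- [OURS] The names of the block are not live. -/
theorem Good.name_not_mem_B {p : Finset ℕ × ℕ} (hp : p ∈ mv) : p.2 ∉ s.B := by
  have _ := hm; have _ := hs
  exact ((BlockPlay.fresh hmv).1 p hp).2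

/-- [OURS] A chart seeing `S` plays: the component `labels S` has a name in the block. -/
theorem Good.exists_name_of_img_eq [DecidableEq L] {c : Chart L Y} (hc : c ∈ 𝒞) {S : Finset L}
    (hS : c.img C = coordIdeal S) : ∃ e, (c.labels S, e) ∈ mv := by
  refine BlockPlay.exists_mem hmv _ (G.mem_components_of_sees hs hc ⟨S, ?_, hS, rfl⟩)
  -- `S ≠ ∅` by `exists_sees_or_top`
  rcases G.exists_sees_or_top hm hs hc with htop | ⟨J, S', hS'ne, hS', -⟩
  · rw [hS] at htop
    exact absurd htop (coordIdeal_isPrime S).ne_top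
  · rwa [G.coordIdeal_injective (hS.symm.trans hS')]

/-- [OURS] A chart missing the centre contains no component. -/
theorem Good.not_subset_cone_of_img_eq_top [DecidableEq L] {c : Chart L Y} (hc : c ∈ 𝒞) (htop : c.img C = ⊤)
    {p : Finset ℕ × ℕ} (hp : p ∈ mv) : ¬ p.1 ⊆ c.cone := by
  intro hsub
  obtain ⟨-, c₁, hc₁, hsees⟩ := G.mem_components_iff.mp ((BlockPlay.fresh hmv).1 p hp).1
  obtain ⟨S, -, hS, -⟩ := Good.Sees.of_subset_cone G hm hs hc hc₁ hsees hsub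
  rw [hS] at htop
  exact (coordIdeal_isPrime S).ne_top htop

/-- [OURS] A component inside the cone of a chart seeing `S` is the one it sees. -/
theorem Good.eq_labels_of_subset_cone [DecidableEq L] {c : Chart L Y} (hc : c ∈ 𝒞) {S : Finset L}
    (hS : c.img C = coordIdeal S) {p : Finset ℕ × ℕ} (hp : p ∈ mv) (hsub : p.1 ⊆ c.cone) :
    p.1 = c.labels S := by
  obtain ⟨-, c₁, hc₁, hsees⟩ := G.mem_components_iff.mp ((BlockPlay.fresh hmv).1 p hp).1
  obtain ⟨S', -, hS', hJ⟩ := Good.Sees.of_subset_cone G hm hs hc hc₁ hsees hsub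
  rw [hJ, G.coordIdeal_injective (hS'.symm.trans hS)]

/-- [OURS · Route K] **The labellings of the new charts are injective.** -/
theorem Good.newCharts_lab_inj [DecidableEq L] {c' : Chart L (blowup C)} (hc' : c' ∈ newCharts 𝒞 C mv) :
    Set.InjOn c'.lab (L : Set ℕ) := by
  rcases hc' with ⟨c, hc, S, hS, j, e, hJe, rfl⟩ | ⟨c, hc, htop, rfl⟩
  · intro b₁ hb₁ b₂ hb₂ h
    simp only [famChart, Chart.ofMap_lab] at h
    have he : ∀ b ∈ (L : Set ℕ), c.lab b ≠ e := fun b hb heq =>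
      G.name_not_mem_B hm hs hmv hJe (heq ▸ G.lab_mem_B hm hs hmv hc ⟨b, hb⟩)
    by_cases h₁ : b₁ = ((j : L) : ℕ) <;> by_cases h₂ : b₂ = ((j : L) : ℕ)
    · rw [h₁, h₂]
    · rw [h₁, Function.update_self, Function.update_of_ne h₂] at h
      exact absurd h.symm (he b₂ hb₂)
    · rw [h₂, Function.update_self, Function.update_of_ne h₁] at h
      exact absurd h (he b₁ hb₁)
    · rw [Function.update_of_ne h₁, Function.update_of_ne h₂] at h
      exact G.lab_inj c hc hb₁ hb₂ h
  · exact G.lab_inj c hc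

/-- [OURS · Route K] **Indices that are not live at the next state carry the unit ideal sheaf.** -/
theorem Good.newD_top {l : ℕ} (hl : l ∉ (s.moves m mv).B) : newD s D C mv l = ⊤ := by
  have _ := hm; have _ := hs; have _ := hmv
  rw [moves_B, Finset.mem_union, not_or] at hl
  refine newD_of_forall_ne D C mv hl.1 fun p hp h => hl.2 ?_
  rw [List.mem_toFinset]
  exact List.mem_map.mpr ⟨p, hp, h⟩

/-! ## (C1) the new charts read the new boundary as coordinate hyperplanes -/

/-- [OURS · Route K] **(C1) at the next level**: the new chart reads `newD (lab' b)` as `(x_b)`. -/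
theorem Good.img_newD [DecidableEq L] {c' : Chart L (blowup C)} (hc' : c' ∈ newCharts 𝒞 C mv) (b : L) :
    c'.img (newD s D C mv (c'.lab b)) = Ideal.span {(MvPolynomial.X b : MvPolynomial L ℚ)} := by
  haveI := G.locNoeth
  haveI : IsLocallyNoetherian (blowup C) := CentreSeq.isLocallyNoetherian_blowup C
  rcases hc' with ⟨c, hc, S, hS, j, e, hJe, rfl⟩ | ⟨c, hc, htop, rfl⟩
  · haveI := (famMap_spec c S hS).1 j
    have hg := (famMap_spec c S hS).2.1 j
    by_cases hbj : b = (j : L)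
    · subst hbj
      rw [famChart_lab_self, newD_of_blockPlay D C hmv hJe]
      exact img_new_comap_of_img_eq_coordIdeal c hS j.2 _ (famMap c S hS j) hg (G.img_stratumIdeal_labels hc S)
    · rw [famChart_lab_of_ne c S hS j e hbj, newD_of_mem D C mv (G.lab_mem_B hm hs hmv hc b)]
      rw [famChart, img_new_strict_of_img_eq_span_X c hS j.2 _ (famMap c S hS j) hg (G.img_D c hc b), if_neg hbj]
  · haveI := (liftMap_spec c htop).1
    change (liftChart c htop).img (newD s D C mv (c.lab b)) = _
    rw [newD_of_mem D C mv (G.lab_mem_B hm hs hmv hc b), liftChart,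
      img_lift_strict c htop c.lab (liftMap c htop) (liftMap_spec c htop).2.1 (D (c.lab b))]
    exact G.img_D c hc b

/-! ## (C1') a new divisor not labelled in the new cone misses the new chart -/

/-- [OURS · Route K] **(C1') at the next level.** -/
theorem Good.img_newD_top [DecidableEq L] {c' : Chart L (blowup C)} (hc' : c' ∈ newCharts 𝒞 C mv) {l : ℕ}
    (hl : l ∉ c'.cone) : c'.img (newD s D C mv l) = ⊤ := by
  haveI := G.locNoeth
  haveI : IsLocallyNoetherian (blowup C) := CentreSeq.isLocallyNoetherian_blowup C
  rcases hc' with ⟨c, hc, S, hS, j, e, hJe, rfl⟩ | ⟨c, hc, htop, rfl⟩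
  · haveI := (famMap_spec c S hS).1 j
    have hg := (famMap_spec c S hS).2.1 j
    rw [cone_famChart c (G.lab_inj c hc) S hS j e, Finset.mem_insert, not_or, Finset.mem_erase, not_and] at hl
    obtain ⟨hle, hl'⟩ := hl
    by_cases hlB : l ∈ s.B
    · rw [newD_of_mem D C mv hlB]
      by_cases hlc : l ∈ c.cone
      · -- then `l = lab j`: the strict transform of the blown-up hyperplane misses the chart
        have hlj : l = c.lab (j : L) := by by_contra h; exact hl' h hlc
        subst hlj
        rw [famChart, img_new_strict_of_img_eq_span_X c hS j.2 _ (famMap c S hS j) hg (G.img_D c hc (j : L)),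
          if_pos rfl]
      · rw [famChart]
        exact img_new_strict_of_img_eq_top c _ (famMap c S hS j) hg (G.img_D_top c hc l hlc)
    · by_cases hp : ∃ p ∈ mv, p.2 = l
      · obtain ⟨⟨J', l'⟩, hp, rfl⟩ := hp
        rw [newD_of_blockPlay D C hmv hp]
        -- `J' ≠ labels S` (names differ), hence `J' ⊄ cone c`, hence read as `⊤`
        have hJ' : ¬ J' ⊆ c.cone := fun hsub => by
          have := G.eq_labels_of_subset_cone hm hs hmv hc hS hp hsub
          simp only at this
          subst this
          have := BlockPlay.eq_of_fst_eq hmv _ hp _ hJe rfl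
          simp only [Prod.mk.injEq, true_and] at this
          exact hle this
        obtain ⟨l₁, hl₁J, hl₁c⟩ := Finset.not_subset.mp hJ'
        rw [famChart]
        exact img_new_comap_of_img_eq_top c _ (famMap c S hS j) hg (G.img_stratumIdeal_eq_top hc hl₁J hl₁c)
      · push Not at hp
        rw [newD_of_forall_ne D C mv hlB hp, Chart.img_top]
  · haveI := (liftMap_spec c htop).1
    have hg := (liftMap_spec c htop).2.1
    change l ∉ c.cone at hl
    by_cases hlB : l ∈ s.B
    · rw [newD_of_mem D C mv hlB, liftChart, img_lift_strict c htop c.lab (liftMap c htop) hg (D l)]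
      exact G.img_D_top c hc l hl
    · by_cases hp : ∃ p ∈ mv, p.2 = l
      · obtain ⟨⟨J', l'⟩, hp, rfl⟩ := hp
        rw [newD_of_blockPlay D C hmv hp]
        obtain ⟨l₁, hl₁J, hl₁c⟩ := Finset.not_subset.mp (G.not_subset_cone_of_img_eq_top hm hs hmv hc htop hp)
        rw [liftChart, img_lift_comap c c.lab (liftMap c htop) hg]
        exact G.img_stratumIdeal_eq_top hc hl₁J hl₁c
      · push Not at hp
        rw [newD_of_forall_ne D C mv hlB hp, Chart.img_top]

end StepFields

end RouteK

end PolyhedraGame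

end Summit.ResolutionOfSingularities.ResolutionOfSingularities.Theorems

end
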